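import Mathlib
import Literature.NumberTheory.Transcendental.PeriodsWave0
import Literature.NumberTheory.Transcendental.PeriodsWave0Proofs
import Literature.NumberTheory.Transcendental.BoxIntegralCatalanLevelFour
import Literature.NumberTheory.Transcendental.KZVolumeConjectureProofs
import Summits.KontsevichZagierPeriods.KontsevichZagierPeriods.Theorems.SoloInformedVolumeLadder
import Summits.KontsevichZagierPeriods.KontsevichZagierPeriods.Theorems.SoloInformedEtaIntegral
import Summits.KontsevichZagierPeriods.KontsevichZagierPeriods.Theorems.SoloInformedLastDilation
import Summits.KontsevichZagierPeriods.KontsevichZagierPeriods.Theorems.SoloInformedSubgraph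
import HarnessLib
import HarnessLib.Audit

/-!
# SoloInformed — faces of the wall: `ζ(5) ∉ ℚ` and Catalan's constant `∉ ℚ` as volume rungs

The conjecture is the conjunction of the volume rungs `Rung_d` (`SoloInformedVolumeLadder`).  This
file identifies, in kernel form, what the rungs `Rung_{n+1}` (`n ≥ 2`) and `Rung_3` decide about two
famous OPEN irrationality questions registered in the Literature library (`ZetaFiveIrrational`,
`OddZetaIrrational`, `CatalanIrrational`, all `[status: open]`).

For a polynomial `q ≥ 1` on `[0,1]ⁿ` let `E_q ⊂ [0,1]ⁿ⁺¹` be the solid under the graph of `1/q`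
(`SoloInformedSubgraph`) and let `NoRel(q)` be the statement that **no positive integers `a, b` give a
move certificate `a·[E_q] − b·[[0,1]ⁿ⁺¹] ∈ relations`** in the Kontsevich–Zagier calculus.  Then

* (`soloInformed_subgraphNoRelation_of_irrational`) `vol E_q ∉ ℚ → NoRel(q)` — unconditionally,
  because the value is a move invariant;
* (`soloInformed_rung_subgraphNoRelation_iff`) **`Rung_{n+1} → (NoRel(q) ↔ vol E_q ∉ ℚ)`** — the
  converse uses the rung once, after realising `a·[E_q]` and `b·[cube]` as the equal-volume solids
  `a ⋆ E_q`, `b ⋆ cube` by an integer dilation of the last coordinate (`SoloInformedLastDilation`).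

Instances:

* `q = 1 + x₀⋯x_{n−1}`: `vol E_q = (1 − 2^{1−n}) ζ(n)` (`SoloInformedEtaIntegral`), so
  **`Rung_{n+1} → (NoRel ↔ ζ(n) ∉ ℚ)`**; in particular **`Rung_6 → (NoRel(η₅) ↔ ZetaFiveIrrational)`**
  and **`KontsevichZagierPeriods → ((∀ k ≥ 1, NoRel(η_{2k+1})) ↔ OddZetaIrrational)`**: under the
  conjecture, the irrationality of the odd zeta values IS the non-existence of these certificates;
* `q = 1 + x₀²x₁²`: `vol E_q = G` (Catalan's constant, `BoxIntegralCatalanLevelFour`), so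
  **`Rung_3 → (NoRel(G) ↔ CatalanIrrational)`** — a face of the FIRST open rung.

This sharpens the fact-conditional implications of
`Literature.Barriers.KontsevichZagierPeriods.GrothendieckPeriodConjectureDependence`
(`zetaFiveIrrational_of_kz`, `oddZetaIrrational_of_kz`) to rung-graded equivalences with an explicit,
minimal combinatorial content (`NoRel`), inside `[0,1]ᵈ` and with integrand `1`.
(The residency's paper, §3bis, proves `NoRel(η_n)` and `NoRel(G)` from the weight grading of the
Hodge–Tate configuration motive — outside the kernel.)

Residency `solo-KontsevichZagierPeriods-informed` (PLAN.md, session s18).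
References: M. Kontsevich, D. Zagier, *Periods* (2001), §1.2; M. Waldschmidt, *Open Diophantine
problems*, Moscow Math. J. 4 (2004), §3; S. Fischler, Sém. Bourbaki 910 (2002/03).
-/

noncomputable section

open MeasureTheory Set Filter
open scoped Topology

namespace Summit.KontsevichZagierPeriods.KontsevichZagierPeriods.Theorems

open Literature.NumberTheory.Transcendental Literature.NumberTheory.Transcendental.KZ

variable {n : ℕ}

/-! ### Generic: no-relation statements for sub-graph solids -/

section Generic

variable (q : MvPolynomial (Fin n) ℚ) (hq : ∀ x ∈ KZ.cube n, (1 : ℝ) ≤ MvPolynomial.aeval x q)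

/-- The evaluation of `a·[E_q] − b·[cube]` is `a · vol E_q − b`. -/
theorem soloInformed_eval_nsmul_subgraph_sub (a b : ℕ) :
    eval (a • of (soloInformedSubgraphRep q hq) - b • of (soloInformedUnitCubeRep (n + 1))) =
      a * (soloInformedSubgraphRep q hq).value - b := by
  simp [map_sub, map_nsmul, eval_of, nsmul_eq_mul]

/-- `vol E_q > 0` (compact with non-empty interior). -/
theorem soloInformed_value_subgraphRep_pos : 0 < (soloInformedSubgraphRep q hq).value := by
  have hE := soloInformed_subgraphRep_isVolume q hq
  have hv : (soloInformedSubgraphRep q hq).value = volume.real (soloInformedSubgraphDom q) := by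
    show ∫ _ in soloInformedSubgraphDom q, (1 : ℝ) = _
    rw [setIntegral_const, smul_eq_mul, mul_one]
  rw [hv]
  refine ENNReal.toReal_pos (ne_of_gt (lt_of_lt_of_le ?_ (measure_mono interior_subset)))
    (isCompact_soloInformedSubgraphDom q hq).measure_lt_top.ne
  exact isOpen_interior.measure_pos volume hE.2.1

/-- **Unconditional half.** If `vol E_q` is irrational then no `a ≥ 1`, `b` give
`a·[E_q] − b·[[0,1]ⁿ⁺¹] ∈ relations`: the value is a move invariant, and the certificate would make
it rational. -/
theorem soloInformed_nsmul_subgraph_sub_not_mem_relations_of_irrational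
    (hirr : Irrational (soloInformedSubgraphRep q hq).value) (a b : ℕ) (ha : a ≠ 0) :
    a • of (soloInformedSubgraphRep q hq) - b • of (soloInformedUnitCubeRep (n + 1)) ∉ relations := by
  intro hmem
  have h0 := eval_eq_zero_of_mem_relations hmem
  rw [soloInformed_eval_nsmul_subgraph_sub] at h0
  have ha' : (a : ℝ) ≠ 0 := by exact_mod_cast ha
  refine hirr ⟨(b : ℚ) / a, ?_⟩
  rw [Rat.cast_div, Rat.cast_natCast, Rat.cast_natCast, div_eq_iff ha']
  linarith

/-- **The rung produces the certificate.** Under `Rung_{n+1}`: if `a · vol E_q = b` then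
`a·[E_q] − b·[[0,1]ⁿ⁺¹] ∈ relations` — apply the rung to the equal-volume solids `a ⋆ E_q` and
`b ⋆ [0,1]ⁿ⁺¹` (integer dilations of the last coordinate) and use `[c ⋆ E] − c·[E] ∈ relations`. -/
theorem soloInformed_rung_nsmul_subgraph_sub_mem_relations (h : SoloInformedVolumeRung (n + 1))
    (a b : ℕ) (ha : a ≠ 0) (hb : b ≠ 0) (hv : (a : ℝ) * (soloInformedSubgraphRep q hq).value = b) :
    a • of (soloInformedSubgraphRep q hq) - b • of (soloInformedUnitCubeRep (n + 1)) ∈ relations := by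
  have hE := soloInformed_subgraphRep_isVolume q hq
  have hI := soloInformed_unitCubeRep_isVolume (n + 1)
  have hK := soloInformed_lastStretchRep_sub_nsmul_mem_relations _ hE.1 hE.2.2 a ha
  have hK' := soloInformed_lastStretchRep_sub_nsmul_mem_relations _ hI.1 hI.2.2 b hb
  have hKK' : Equivalent (soloInformedLastStretchRep (soloInformedSubgraphRep q hq) hE.1 a)
      (soloInformedLastStretchRep (soloInformedUnitCubeRep (n + 1)) hI.1 b) :=
    h _ _ (isCompact_soloInformedLastStretchRep_domain _ hE.1 a)
      (soloInformed_interior_lastStretchRep_nonempty _ hE.1 a ha hE.2.1)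
      (isCompact_soloInformedLastStretchRep_domain _ hI.1 b)
      (soloInformed_interior_lastStretchRep_nonempty _ hI.1 b hb hI.2.1)
      (soloInformedLastStretchRep_integrand _ hE.1 a)
      (soloInformedLastStretchRep_integrand _ hI.1 b)
      (by rw [soloInformed_value_lastStretchRep _ hE.1 hE.2.2 a ha,
        soloInformed_value_lastStretchRep _ hI.1 hI.2.2 b hb, hv, soloInformed_value_unitCubeRep,
        mul_one])
  have e : a • of (soloInformedSubgraphRep q hq) - b • of (soloInformedUnitCubeRep (n + 1)) =
      (of (soloInformedLastStretchRep (soloInformedSubgraphRep q hq) hE.1 a) -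
          of (soloInformedLastStretchRep (soloInformedUnitCubeRep (n + 1)) hI.1 b)) -
        (of (soloInformedLastStretchRep (soloInformedSubgraphRep q hq) hE.1 a) -
          a • of (soloInformedSubgraphRep q hq)) +
        (of (soloInformedLastStretchRep (soloInformedUnitCubeRep (n + 1)) hI.1 b) -
          b • of (soloInformedUnitCubeRep (n + 1))) := by
    abel
  rw [e]
  exact relations.add_mem (relations.sub_mem hKK' hK) hK'

/-- **`Rung_{n+1} → (NoRel(q) ↔ vol E_q ∉ ℚ)`**, where `NoRel(q)` says that no positive integers
`a, b` give a move certificate `a·[E_q] − b·[[0,1]ⁿ⁺¹] ∈ relations`. -/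
theorem soloInformed_rung_subgraphNoRelation_iff (h : SoloInformedVolumeRung (n + 1)) :
    (∀ a b : ℕ, a ≠ 0 → b ≠ 0 →
        a • of (soloInformedSubgraphRep q hq) - b • of (soloInformedUnitCubeRep (n + 1)) ∉ relations) ↔
      Irrational (soloInformedSubgraphRep q hq).value := by
  refine ⟨fun hno => ?_, fun hirr a b ha _ =>
    soloInformed_nsmul_subgraph_sub_not_mem_relations_of_irrational q hq hirr a b ha⟩
  by_contra hrat
  obtain ⟨r, hr⟩ : (soloInformedSubgraphRep q hq).value ∈ Set.range ((↑) : ℚ → ℝ) :=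
    not_not.1 hrat
  have hpos := soloInformed_value_subgraphRep_pos q hq
  have hr0 : 0 < r := by
    rw [← hr] at hpos
    exact_mod_cast hpos
  have hnum : 0 < r.num := Rat.num_pos.2 hr0
  have hcast : ((r.num.toNat : ℕ) : ℝ) = (r.num : ℝ) := by
    rw [← Int.cast_natCast, Int.toNat_of_nonneg hnum.le]
  have hden : (r.den : ℝ) ≠ 0 := by exact_mod_cast r.den_nz
  refine hno r.den r.num.toNat r.den_nz (by omega)
    (soloInformed_rung_nsmul_subgraph_sub_mem_relations q hq h _ _ r.den_nz (by omega) ?_)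
  rw [hcast, ← hr, Rat.cast_def]
  field_simp

end Generic

/-! ### Face 1: `q = 1 + x₀⋯x_{n−1}`, volume `(1 − 2^{1−n}) ζ(n)` -/

/-- `1 + x₀ x₁ ⋯ x_{n−1} ∈ ℚ[x]`. -/
def soloInformedEtaPoly (n : ℕ) : MvPolynomial (Fin n) ℚ := 1 + ∏ i, MvPolynomial.X i

/-- `(1 + x₀⋯x_{n−1})(x) = 1 + ∏ xᵢ`. -/
@[simp] theorem soloInformed_aeval_etaPoly (x : Fin n → ℝ) :
    (MvPolynomial.aeval x (soloInformedEtaPoly n) : ℝ) = 1 + ∏ i, x i := by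
  simp [soloInformedEtaPoly, map_prod]

/-- `1 + ∏ xᵢ ≥ 1` on the cube. -/
theorem soloInformed_etaPoly_ge_one (n : ℕ) :
    ∀ x ∈ KZ.cube n, (1 : ℝ) ≤ MvPolynomial.aeval x (soloInformedEtaPoly n) := by
  intro x hx
  rw [soloInformed_aeval_etaPoly]
  have : 0 ≤ ∏ i, x i := Finset.prod_nonneg fun i _ => (hx i).1
  linarith

/-- **The solid `E_η(n) = {(x,t) ∈ [0,1]ⁿ⁺¹ : t (1 + x₀⋯x_{n−1}) ≤ 1}`.** -/
def soloInformedEtaSolid (n : ℕ) : IntegralRep (n + 1) :=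
  soloInformedSubgraphRep (soloInformedEtaPoly n) (soloInformed_etaPoly_ge_one n)

/-- **`vol E_η(n) = (1 − 2/2ⁿ) ζ(n)`** (`n ≥ 2`). -/
theorem soloInformed_value_etaSolid (hn : 2 ≤ n) :
    (soloInformedEtaSolid n).value = (1 - 2 / 2 ^ n) * zetaValue n := by
  rw [soloInformedEtaSolid, soloInformed_value_subgraphRep, ← soloInformed_setIntegral_cube_inv_one_add_prod hn]
  exact setIntegral_congr_fun KZ.measurableSet_cube fun x _ => by rw [soloInformed_aeval_etaPoly]

/-- **Unconditional: `ζ(n) ∉ ℚ →` no certificate `a·[E_η(n)] − b·[[0,1]ⁿ⁺¹] ∈ relations**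
(`n ≥ 2`, `a ≥ 1`). -/
theorem soloInformed_eta_not_mem_relations_of_irrational (hn : 2 ≤ n)
    (hirr : Irrational (zetaValue n)) (a b : ℕ) (ha : a ≠ 0) :
    a • of (soloInformedEtaSolid n) - b • of (soloInformedUnitCubeRep (n + 1)) ∉ relations := by
  refine soloInformed_nsmul_subgraph_sub_not_mem_relations_of_irrational _ _ ?_ a b ha
  show Irrational (soloInformedEtaSolid n).value
  rw [soloInformed_value_etaSolid hn]
  exact (soloInformed_irrational_factor_mul_zetaValue_iff hn).2 hirr

/-- **`Rung_{n+1} → (NoRel(η_n) ↔ ζ(n) ∉ ℚ)`** (`n ≥ 2`): under the volume rung of dimension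
`n + 1`, the irrationality of `ζ(n)` is exactly the non-existence of a move certificate
`a·[E_η(n)] − b·[[0,1]ⁿ⁺¹] ∈ relations` with `a, b ≥ 1`. -/
theorem soloInformed_rung_etaNoRelation_iff (hn : 2 ≤ n) (h : SoloInformedVolumeRung (n + 1)) :
    (∀ a b : ℕ, a ≠ 0 → b ≠ 0 →
        a • of (soloInformedEtaSolid n) - b • of (soloInformedUnitCubeRep (n + 1)) ∉ relations) ↔
      Irrational (zetaValue n) := by
  have e := soloInformed_rung_subgraphNoRelation_iff (soloInformedEtaPoly n)
    (soloInformed_etaPoly_ge_one n) h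
  have hv : (soloInformedSubgraphRep (soloInformedEtaPoly n) (soloInformed_etaPoly_ge_one n)).value =
      (1 - 2 / 2 ^ n) * zetaValue n := soloInformed_value_etaSolid hn
  rw [hv, soloInformed_irrational_factor_mul_zetaValue_iff hn] at e
  exact e

/-- **`NoRel(η₅)`** (OPEN — under `Rung_6` equivalent to, and unconditionally implied by,
`ZetaFiveIrrational`): no positive integers `a, b` with `a·[E_η(5)] − b·[[0,1]⁶] ∈ relations`,
where `E_η(5) = {(x, t) ∈ [0,1]⁶ : t (1 + x₀x₁x₂x₃x₄) ≤ 1}` has volume `(15/16) ζ(5)`. -/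
@[conjecture] def SoloInformedEtaFiveNoRelation : Prop :=
  ∀ a b : ℕ, a ≠ 0 → b ≠ 0 →
    a • of (soloInformedEtaSolid 5) - b • of (soloInformedUnitCubeRep 6) ∉ relations

/-- **Face of `Rung_6`: `Rung_6 → (NoRel(η₅) ↔ ζ(5) ∉ ℚ)`.** -/
theorem soloInformed_rung_six_etaFiveNoRelation_iff_zetaFiveIrrational (h : SoloInformedVolumeRung 6) :
    SoloInformedEtaFiveNoRelation ↔ ZetaFiveIrrational :=
  soloInformed_rung_etaNoRelation_iff (n := 5) (by norm_num) h

/-- `KontsevichZagierPeriods → (NoRel(η₅) ↔ ζ(5) ∉ ℚ)`. -/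
theorem soloInformed_kz_etaFiveNoRelation_iff_zetaFiveIrrational (hKZ : KontsevichZagierPeriods) :
    SoloInformedEtaFiveNoRelation ↔ ZetaFiveIrrational :=
  soloInformed_rung_six_etaFiveNoRelation_iff_zetaFiveIrrational
    (soloInformed_kontsevichZagierPeriods_iff_forall_rung.1 hKZ 6)

/-- `ζ(5) ∉ ℚ → NoRel(η₅)`, unconditionally. -/
theorem soloInformed_etaFiveNoRelation_of_zetaFiveIrrational (h : ZetaFiveIrrational) :
    SoloInformedEtaFiveNoRelation :=
  fun a b ha _ => soloInformed_eta_not_mem_relations_of_irrational (by norm_num) h a b ha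

/-- `ζ(3) ∉ ℚ` (Apéry, tree theorem `irrational_zetaValue_three_holds`) gives `NoRel(η₃)`
unconditionally: no chain of moves certifies `a · (3/4) ζ(3) = b`. -/
theorem soloInformed_eta_three_not_mem_relations (a b : ℕ) (ha : a ≠ 0) :
    a • of (soloInformedEtaSolid 3) - b • of (soloInformedUnitCubeRep 4) ∉ relations :=
  soloInformed_eta_not_mem_relations_of_irrational (by norm_num) irrational_zetaValue_three_holds a b ha

/-- **Under the conjecture, `OddZetaIrrational` IS the family of no-relation statements:**
`KontsevichZagierPeriods → ((∀ k ≥ 1, NoRel(η_{2k+1})) ↔ OddZetaIrrational)`. -/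
theorem soloInformed_kz_forall_etaNoRelation_iff_oddZetaIrrational (hKZ : KontsevichZagierPeriods) :
    (∀ k : ℕ, 1 ≤ k → ∀ a b : ℕ, a ≠ 0 → b ≠ 0 →
        a • of (soloInformedEtaSolid (2 * k + 1)) - b • of (soloInformedUnitCubeRep (2 * k + 1 + 1)) ∉
          relations) ↔ OddZetaIrrational := by
  have hr := soloInformed_kontsevichZagierPeriods_iff_forall_rung.1 hKZ
  refine forall_congr' fun k => imp_congr_right fun hk => ?_
  exact soloInformed_rung_etaNoRelation_iff (by omega) (hr _)

/-- `OddZetaIrrational → ∀ k ≥ 1, NoRel(η_{2k+1})`, unconditionally. -/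
theorem soloInformed_forall_eta_not_mem_relations_of_oddZetaIrrational (h : OddZetaIrrational)
    (k : ℕ) (hk : 1 ≤ k) (a b : ℕ) (ha : a ≠ 0) :
    a • of (soloInformedEtaSolid (2 * k + 1)) - b • of (soloInformedUnitCubeRep (2 * k + 1 + 1)) ∉
      relations :=
  soloInformed_eta_not_mem_relations_of_irrational (by omega) (h k hk) a b ha

/-! ### Face 2: `q = 1 + x₀² x₁²`, volume Catalan's constant — a face of `Rung_3` -/

/-- `1 + x₀² x₁² ∈ ℚ[x₀, x₁]`. -/
def soloInformedCatalanPoly : MvPolynomial (Fin 2) ℚ :=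
  1 + MvPolynomial.X 0 ^ 2 * MvPolynomial.X 1 ^ 2

/-- `(1 + x₀²x₁²)(x) = 1 + (x₀ x₁)²`. -/
@[simp] theorem soloInformed_aeval_catalanPoly (x : Fin 2 → ℝ) :
    (MvPolynomial.aeval x soloInformedCatalanPoly : ℝ) = 1 + (x 0 * x 1) ^ 2 := by
  simp [soloInformedCatalanPoly, mul_pow]

/-- `1 + (x₀x₁)² ≥ 1`. -/
theorem soloInformed_catalanPoly_ge_one :
    ∀ x ∈ KZ.cube 2, (1 : ℝ) ≤ MvPolynomial.aeval x soloInformedCatalanPoly := by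
  intro x _
  rw [soloInformed_aeval_catalanPoly]
  nlinarith [sq_nonneg (x 0 * x 1)]

/-- **The solid `E_G = {(x, y, t) ∈ [0,1]³ : t (1 + x²y²) ≤ 1}`.** -/
def soloInformedCatalanSolid : IntegralRep 3 :=
  soloInformedSubgraphRep soloInformedCatalanPoly soloInformed_catalanPoly_ge_one

/-- **`vol E_G = G`** (Catalan's constant `∑ (−1)ᵏ/(2k+1)²`). -/
theorem soloInformed_value_catalanSolid : soloInformedCatalanSolid.value = catalanConstant := by
  rw [soloInformedCatalanSolid, soloInformed_value_subgraphRep,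
    ← BoxIntegral.setIntegral_box_one_div_one_add_sq,
    ← soloInformed_setIntegral_cube_eq_box 2 (fun x : Fin 2 → ℝ => 1 / (1 + (x 0 * x 1) ^ 2))]
  exact setIntegral_congr_fun KZ.measurableSet_cube fun x _ => by
    rw [soloInformed_aeval_catalanPoly, inv_eq_one_div]

/-- **`NoRel(G)`** (OPEN — under `Rung_3` equivalent to, and unconditionally implied by,
`CatalanIrrational`): no positive integers `a, b` with `a·[E_G] − b·[[0,1]³] ∈ relations`, where
`E_G = {(x, y, t) ∈ [0,1]³ : t (1 + x²y²) ≤ 1}` has volume Catalan's constant. -/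
@[conjecture] def SoloInformedCatalanNoRelation : Prop :=
  ∀ a b : ℕ, a ≠ 0 → b ≠ 0 →
    a • of soloInformedCatalanSolid - b • of (soloInformedUnitCubeRep 3) ∉ relations

/-- **Unconditional: `G ∉ ℚ → NoRel(G)`.** -/
theorem soloInformed_catalanNoRelation_of_catalanIrrational (h : CatalanIrrational) :
    SoloInformedCatalanNoRelation := by
  intro a b ha _
  refine soloInformed_nsmul_subgraph_sub_not_mem_relations_of_irrational _ _ ?_ a b ha
  show Irrational soloInformedCatalanSolid.value
  rw [soloInformed_value_catalanSolid]
  exact h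

/-- **Face of `Rung_3`: `Rung_3 → (NoRel(G) ↔ CatalanIrrational)`** — under the first open volume
rung, the irrationality of Catalan's constant (OPEN) is exactly the non-existence of a move
certificate `a·[E_G] − b·[[0,1]³] ∈ relations`. -/
theorem soloInformed_rung_three_catalanNoRelation_iff_catalanIrrational (h : SoloInformedVolumeRung 3) :
    SoloInformedCatalanNoRelation ↔ CatalanIrrational := by
  have e := soloInformed_rung_subgraphNoRelation_iff soloInformedCatalanPoly
    soloInformed_catalanPoly_ge_one h
  have hv : (soloInformedSubgraphRep soloInformedCatalanPoly soloInformed_catalanPoly_ge_one).value =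
      catalanConstant := soloInformed_value_catalanSolid
  rw [hv] at e
  exact e

/-- `KontsevichZagierPeriods → (NoRel(G) ↔ CatalanIrrational)`. -/
theorem soloInformed_kz_catalanNoRelation_iff_catalanIrrational (hKZ : KontsevichZagierPeriods) :
    SoloInformedCatalanNoRelation ↔ CatalanIrrational :=
  soloInformed_rung_three_catalanNoRelation_iff_catalanIrrational
    (soloInformed_kontsevichZagierPeriods_iff_forall_rung.1 hKZ 3)

end Summit.KontsevichZagierPeriods.KontsevichZagierPeriods.Theorems
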